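import Summits.QuantumAdvantage.QuantumAdvantage.Theorems.CubicForrelationNearExactIsExactTwelveLevelFiveAlphaSign

/-!
# Crux `CubicForrelation.NearExactIsExact` (stmt-QuantumAdvantage-14043) — n = 12: a LEVEL-5 side in CASE α is IMPOSSIBLE on the open
  window `(57/64, 29/32)`; every side of a window pair is TYPE O

Certificate seat `b2b-cforr-cert` (gen 30).  HONEST FRAMING: kernel-checked finite-slice theorems (standard axioms) about cubic Boolean pairs on 12
bits.  NO new value of `θ₁₂` (still `∈ [57/64, 29/32)`); what is excluded is one of the two remaining side shapes (`tz29_window_side_shape`):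
after this file only pairs with BOTH sides of type O can live on the open window.  NOT summit progress.

The kill (HOME/b2b-cforr-cert-g30 notes).  `W_g = 32u'`, `e = u' − 2(−1)^f`, `P = x₀ ⊕ V`, `A₂ = c ⊕ V₁` (8-flat, `E_off ≥ 1024`), slack
`Σ_P(e² − 1) + Σ_{off P} e² ≤ 1535`.  PROXY `S = σ₅·1_P + 2η·1_{A₂}` (`σ₅ = (−1)^{hb}`, `η = (−1)^{hη}`, `e ≡ σ₅ (mod 4)` on `P`, `e ≡ 2η
(mod 8)` on `A₂`, `4 ∣ e` elsewhere):
* `tzk_proxy_bound`: `Σ (e − S)² ≤ 2·(1535 − 1024) = 1022` (pointwise `(e−σ)² ≤ 2(e²−1)`, `(e−2η)² ≤ 2(e²−4)`).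
* `tzk_Shat`: `Ŝ(y) ∈ 256ℤ` for every `y` (`tzj_sigma_char` + `tzb_eta_char`).
* `tzk_alpha_window_false`: Walsh inversion `ê = 128(−1)^g − 2W_f` and Parseval give `Σ_y (128(−1)^g − 2W_f − Ŝ)² = 4096·Σ(e − S)²
  ≤ 4096·1022`; but the partner `f` is type O (`2W_f = 32u_f`, `u_f` odd: every term `≥ 32² = 1024`, total `≥ 4096·1024`), level 5
  (`2W_f = 64u'_f`, `u'_f` odd on `≥ 2048` frequencies: those terms `≥ 64²`, total `≥ 2²³`) or level `≥ 6` (`tz_levelSix_window_false`).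
* `tz30_window_side_typeO`: on the open window `57/64 < Φ < 1` the `g`-side is type O (`W_g = 16u`, all `u` odd); `tz30_window_pair_typeO`:
  so is the `f`-side.

References: J. Ax (1964) / R. J. McEliece (1972); MacWilliams–Sloane (1977) Ch. 13–15; R. O'Donnell (2014) §1.4 (Parseval).  Axioms: the standard
three.
-/

set_option linter.dupNamespace false -- D-0017: single-problem summit ⇒ `QuantumAdvantage.QuantumAdvantage` by design

noncomputable section

namespace Summit.QuantumAdvantage.QuantumAdvantage.Theorems.CubicForrelation.NearExactIsExact

open Finset
open Literature.Computability.QuantumComplexity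
open Literature.Computability.QuantumComplexity.BuzetChailloux (bxor zeroVec bxor_bxor_cancel_left bxor_zeroVec zeroVec_bxor bxor_comm
  bxor_self)
open Literature.Computability.QuantumComplexity.DerivativeWalsh (W sum_W_sq)

/-- On `A₂` (`e ≡ 2 (mod 4)`): `(e − 2η)² ≤ 2(e² − 4)` for `η = sZ [e ≡ 6 (mod 8)]`. [folklore] -/
theorem tzk_pw_A2 {e : ℤ} (h2 : e % 4 = 2) : (e - 2 * sZ (decide (e % 8 = 6))) ^ 2 ≤ 2 * (e ^ 2 - 4) := by
  obtain ⟨k, hk⟩ := tzb_eta_mod8 h2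
  rcases tp_sZ_cases (decide (e % 8 = 6)) with hη | hη <;> rw [hη] at hk ⊢
  · have he : e = 2 + 8 * k := by omega
    subst he
    rcases le_or_gt 0 k with h | h <;> nlinarith
  · have he : e = -2 + 8 * k := by omega
    subst he
    rcases le_or_gt k 0 with h | h <;> nlinarith

/-- **The proxy bound.**  On the window in case α (`A₂ = {u' even, 4 ∤ e} = c ⊕ V₁`, `#V₁ = 256`, slack `≤ 1535`): with
`S = σ₅` on `P`, `2η` on `A₂`, `0` elsewhere, `Σ_x (e − S)² ≤ 1022`.  Finite-slice statement, NOT summit progress. [this work] -/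
theorem tzk_proxy_bound (f : (Fin (6 + 6) → Bool) → Bool) (u' : (Fin (6 + 6) → Bool) → ℤ)
    (c : Fin (6 + 6) → Bool) (V₁ : Finset (Fin (6 + 6) → Bool)) (h1card : #V₁ = 256)
    (hA2 : (univ.filter fun y : Fin (6 + 6) → Bool => ¬ Odd (u' y) ∧ ¬ (4 : ℤ) ∣ u' y - 2 * sZ (f y)) = V₁.image (bxor c))
    (hbud : ∑ x ∈ univ.filter (fun x : Fin (6 + 6) → Bool => Odd (u' x)), ((u' x - 2 * sZ (f x)) ^ 2 - 1) +
        ∑ y ∈ univ.filter (fun y : Fin (6 + 6) → Bool => ¬ Odd (u' y)), (u' y - 2 * sZ (f y)) ^ 2 ≤ 1535) :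
    (∑ x, (u' x - 2 * sZ (f x) -
      (if Odd (u' x) then sZ (decide ((u' x - 2 * sZ (f x)) % 4 = 3))
        else if ¬ (4 : ℤ) ∣ u' x - 2 * sZ (f x) then 2 * sZ (decide ((u' x - 2 * sZ (f x)) % 8 = 6)) else 0)) ^ 2 : ℤ) ≤ 1022 := by
  classical
  set e : (Fin (6 + 6) → Bool) → ℤ := fun x => u' x - 2 * sZ (f x) with hedef
  set P := univ.filter (fun x : Fin (6 + 6) → Bool => Odd (u' x)) with hPdef
  set P' := univ.filter (fun y : Fin (6 + 6) → Bool => ¬ Odd (u' y)) with hP'def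
  set q : (Fin (6 + 6) → Bool) → ℤ := fun x => (e x - (if Odd (u' x) then sZ (decide (e x % 4 = 3))
      else if ¬ (4 : ℤ) ∣ e x then 2 * sZ (decide (e x % 8 = 6)) else 0)) ^ 2 with hqdef
  show ∑ x, q x ≤ 1022
  have hmemP : ∀ x, x ∈ P ↔ Odd (u' x) := fun x => by simp [hPdef]
  have hsplit : ∀ F : (Fin (6 + 6) → Bool) → ℤ, ∑ x, F x = ∑ x ∈ P, F x + ∑ x ∈ P', F x := fun F =>
    (sum_filter_add_sum_filter_not univ (fun x => Odd (u' x)) F).symm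
  set A := P'.filter (fun y => ¬ (4 : ℤ) ∣ e y) with hAdef
  set R := P'.filter (fun y => (4 : ℤ) ∣ e y) with hRdef
  have hsplit' : ∀ F : (Fin (6 + 6) → Bool) → ℤ, ∑ x ∈ P', F x = ∑ x ∈ A, F x + ∑ x ∈ R, F x := fun F =>
    ((sum_filter_add_sum_filter_not P' (fun y => (4 : ℤ) ∣ e y) F).symm.trans (add_comm _ _))
  have hAeq : A = V₁.image (bxor c) := by
    rw [← hA2, hAdef, hP'def, filter_filter]
  have hAcard : #A = 256 := by rw [hAeq, card_image_of_injective _ (iw_bxor_injective c), h1card]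
  -- pointwise bounds
  have hqP : ∀ x ∈ P, q x ≤ 2 * (e x ^ 2 - 1) := by
    intro x hx
    have hx' := (hmemP x).1 hx
    simp only [q, if_pos hx']
    exact tzc_pw_two (tp_sZ_cases _) (tzl5_mod4 f u' hx')
  have hqA : ∀ x ∈ A, q x ≤ 2 * (e x ^ 2 - 4) := by
    intro x hx
    obtain ⟨hx1, hx4⟩ := mem_filter.1 hx
    have hx1' : ¬ Odd (u' x) := (mem_filter.1 hx1).2
    simp only [q, if_neg hx1', if_pos hx4]
    exact tzk_pw_A2 (tzb_A2_mod4 f u' hx1' hx4)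
  have hqR : ∀ x ∈ R, q x = e x ^ 2 := by
    intro x hx
    obtain ⟨hx1, hx4⟩ := mem_filter.1 hx
    have hx1' : ¬ Odd (u' x) := (mem_filter.1 hx1).2
    simp only [q, if_neg hx1', hx4, not_true_eq_false, if_false, sub_zero]
  have hRnn : 0 ≤ ∑ x ∈ R, e x ^ 2 := sum_nonneg fun _ _ => sq_nonneg _
  have h1 : ∑ x ∈ P, q x ≤ 2 * ∑ x ∈ P, (e x ^ 2 - 1) := by rw [mul_sum]; exact sum_le_sum hqP
  have h2 : ∑ x ∈ A, q x ≤ 2 * ∑ x ∈ A, e x ^ 2 - 8 * 256 := by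
    have h := sum_le_sum hqA
    rw [← mul_sum, sum_sub_distrib, sum_const, hAcard, nsmul_eq_mul] at h
    push_cast at h
    linarith
  have h3 : ∑ x ∈ R, q x = ∑ x ∈ R, e x ^ 2 := sum_congr rfl hqR
  have hbud' : ∑ x ∈ P, (e x ^ 2 - 1) + ∑ y ∈ P', e y ^ 2 ≤ 1535 := hbud
  rw [hsplit' (fun y => e y ^ 2)] at hbud'
  rw [hsplit q, hsplit' q, h3]
  linarith

/-- **`Ŝ ∈ 256ℤ`.**  On the window in case α the Walsh transform of the proxy `S` takes only multiples of `256` as values.  Finite-slice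
statement, NOT summit progress. [this work] -/
theorem tzk_Shat (f g : (Fin (6 + 6) → Bool) → Bool) (hf : IsDegLeFun 3 f) (hg : IsDegLeFun 3 g)
    (u' : (Fin (6 + 6) → Bool) → ℤ) (hu' : ∀ x, W (fun y => signOf (g y)) x = (2 : ℝ) ^ 5 * (u' x : ℝ))
    (V : Finset (Fin (6 + 6) → Bool)) (x₀ : Fin (6 + 6) → Bool) (h0 : zeroVec ∈ V) (hadd : ∀ a ∈ V, ∀ b ∈ V, bxor a b ∈ V)
    (hcardV : #V = 2048) (hP : (univ.filter fun x : Fin (6 + 6) → Bool => Odd (u' x)) = V.image (bxor x₀))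
    (c : Fin (6 + 6) → Bool) (V₁ : Finset (Fin (6 + 6) → Bool)) (hsub : V₁ ⊆ V) (h10 : zeroVec ∈ V₁)
    (h1add : ∀ a ∈ V₁, ∀ b ∈ V₁, bxor a b ∈ V₁) (h1card : #V₁ = 256)
    (hPc : (univ.filter fun x : Fin (6 + 6) → Bool => ¬ Odd (u' x)) = V.image (bxor c))
    (hA2 : (univ.filter fun y : Fin (6 + 6) → Bool => ¬ Odd (u' y) ∧ ¬ (4 : ℤ) ∣ u' y - 2 * sZ (f y)) = V₁.image (bxor c))
    (hper : ∀ v ∈ V₁, ∀ y, ¬ Odd (u' y) →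
      ((4 : ℤ) ∣ u' (bxor y v) - 2 * sZ (f (bxor y v)) ↔ (4 : ℤ) ∣ u' y - 2 * sZ (f y)))
    (hbud : ∑ x ∈ univ.filter (fun x : Fin (6 + 6) → Bool => Odd (u' x)), ((u' x - 2 * sZ (f x)) ^ 2 - 1) +
        ∑ y ∈ univ.filter (fun y : Fin (6 + 6) → Bool => ¬ Odd (u' y)), (u' y - 2 * sZ (f y)) ^ 2 ≤ 1535)
    (y : Fin (6 + 6) → Bool) :
    ∃ k : ℤ, ∑ a, (((if Odd (u' a) then sZ (decide ((u' a - 2 * sZ (f a)) % 4 = 3))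
        else if ¬ (4 : ℤ) ∣ u' a - 2 * sZ (f a) then 2 * sZ (decide ((u' a - 2 * sZ (f a)) % 8 = 6)) else 0 : ℤ)) : ℝ) *
        twist a y = 256 * (k : ℝ) := by
  classical
  set e : (Fin (6 + 6) → Bool) → ℤ := fun x => u' x - 2 * sZ (f x) with hedef
  set P := univ.filter (fun x : Fin (6 + 6) → Bool => Odd (u' x)) with hPdef
  set P' := univ.filter (fun y : Fin (6 + 6) → Bool => ¬ Odd (u' y)) with hP'def
  have hmemP : ∀ x, x ∈ P ↔ Odd (u' x) := fun x => by simp [hPdef]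
  set S : (Fin (6 + 6) → Bool) → ℤ := fun a => if Odd (u' a) then sZ (decide (e a % 4 = 3))
      else if ¬ (4 : ℤ) ∣ e a then 2 * sZ (decide (e a % 8 = 6)) else 0 with hSdef
  show ∃ k : ℤ, ∑ a, ((S a : ℤ) : ℝ) * twist a y = 256 * (k : ℝ)
  have hsplit : ∑ a, ((S a : ℤ) : ℝ) * twist a y = ∑ a ∈ P, ((S a : ℤ) : ℝ) * twist a y + ∑ a ∈ P', ((S a : ℤ) : ℝ) * twist a y :=
    (sum_filter_add_sum_filter_not univ (fun x => Odd (u' x)) _).symm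
  set A := P'.filter (fun y => ¬ (4 : ℤ) ∣ e y) with hAdef
  have hAeq : A = V₁.image (bxor c) := by
    rw [← hA2, hAdef, hP'def, filter_filter]
  have hPsum : ∑ a ∈ P, ((S a : ℤ) : ℝ) * twist a y =
      ∑ x ∈ univ.filter (fun x : Fin (6 + 6) → Bool => Odd (u' x)), signOf (decide ((u' x - 2 * sZ (f x)) % 4 = 3)) * twist x y := by
    refine sum_congr rfl fun a ha => ?_
    simp only [S, e, if_pos ((hmemP a).1 ha), tp_sZ_cast]
  have hP'sum : ∑ a ∈ P', ((S a : ℤ) : ℝ) * twist a y =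
      2 * ∑ x ∈ V₁.image (bxor c), signOf (decide ((u' x - 2 * sZ (f x)) % 8 = 6)) * twist x y := by
    have hsp : ∑ a ∈ P', ((S a : ℤ) : ℝ) * twist a y =
        ∑ a ∈ A, ((S a : ℤ) : ℝ) * twist a y + ∑ a ∈ P'.filter (fun y => (4 : ℤ) ∣ e y), ((S a : ℤ) : ℝ) * twist a y :=
      (sum_filter_add_sum_filter_not P' (fun y => (4 : ℤ) ∣ e y) _).symm.trans (add_comm _ _)
    have hR0 : ∑ a ∈ P'.filter (fun y => (4 : ℤ) ∣ e y), ((S a : ℤ) : ℝ) * twist a y = 0 := by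
      refine sum_eq_zero fun a ha => ?_
      obtain ⟨ha1, ha4⟩ := mem_filter.1 ha
      have ha' : ¬ Odd (u' a) := (mem_filter.1 ha1).2
      simp only [S, if_neg ha', if_neg (not_not.2 ha4)]
      push_cast
      ring
    rw [hsp, hR0, add_zero, ← hAeq, mul_sum]
    refine sum_congr rfl fun a ha => ?_
    obtain ⟨ha1, ha4⟩ := mem_filter.1 ha
    have ha' : ¬ Odd (u' a) := (mem_filter.1 ha1).2
    simp only [S, e, if_neg ha', if_pos ha4]
    push_cast
    rw [tp_sZ_cast]
    ring
  obtain ⟨k₁, hk₁⟩ := tzj_sigma_char f g hf hg u' hu' V x₀ h0 hadd hcardV hP c V₁ hsub h10 h1add h1card hPc hA2 hper hbud y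
  obtain ⟨k₂, -, hk₂⟩ := tzb_eta_char f g hf hg u' hu' V hadd hcardV c V₁ hsub h1add h1card hPc hA2 hbud y
  refine ⟨k₁ + 2 * k₂, ?_⟩
  rw [hsplit, hPsum, hP'sum, hk₁, hk₂]
  push_cast
  ring

/-- **A LEVEL-5 SIDE IN CASE α IS IMPOSSIBLE ON THE OPEN WINDOW.**  Cubic `f, g` on 12 bits, `W_g = 32u'` with some `u'` odd,
`57/64 < Φ(f,g) < 1`, and some point with `u'` even and `4 ∤ u' − 2(−1)^f` ⇒ `False`.  [Proxy squeeze: `Σ(e − S)² ≤ 1022` vs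
`Ŝ ∈ 256ℤ` and a type-O / level-5 / level-6 partner.]  Finite-slice statement, NOT summit progress. [this work] -/
theorem tzk_alpha_window_false (f g : (Fin (6 + 6) → Bool) → Bool) (hf : IsDegLeFun 3 f) (hg : IsDegLeFun 3 g)
    (u' : (Fin (6 + 6) → Bool) → ℤ) (hu' : ∀ x, W (fun y => signOf (g y)) x = (2 : ℝ) ^ 5 * (u' x : ℝ)) (hodd : ∃ x, Odd (u' x))
    (hlo : (57 / 64 : ℝ) < forrelation f g) (hhi : forrelation f g < 1)
    (hα : ∃ y, ¬ Odd (u' y) ∧ ¬ (4 : ℤ) ∣ u' y - 2 * sZ (f y)) : False := by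
  classical
  obtain ⟨V, x₀, c, V₁, h0, hadd, hcardV, hP, -, -, hPc, hsub, h10, h1add, h1card, hA2, hper, -, hbud⟩ :=
    tza_window_alpha f g hf hg u' hu' hodd hlo hα
  set e : (Fin (6 + 6) → Bool) → ℤ := fun x => u' x - 2 * sZ (f x) with hedef
  set S : (Fin (6 + 6) → Bool) → ℤ := fun a => if Odd (u' a) then sZ (decide (e a % 4 = 3))
      else if ¬ (4 : ℤ) ∣ e a then 2 * sZ (decide (e a % 8 = 6)) else 0 with hSdef
  have hpi : (∑ x, (e x - S x) ^ 2 : ℤ) ≤ 1022 := tzk_proxy_bound f u' c V₁ h1card hA2 hbud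
  have hShat : ∀ y, ∃ k : ℤ, ∑ a, ((S a : ℤ) : ℝ) * twist a y = 256 * (k : ℝ) :=
    fun y => tzk_Shat f g hf hg u' hu' V x₀ h0 hadd hcardV hP c V₁ hsub h10 h1add h1card hPc hA2 hper hbud y
  choose kS hkS using hShat
  -- the bridge `Σ_y (128 s_g − 2W_f − 256 k_y)² = 4096 Σ (e − S)² ≤ 4096·1022`
  have hW : ∀ y, W (fun a => (((e a - S a : ℤ)) : ℝ)) y = 128 * signOf (g y) - 2 * W (fun x => signOf (f x)) y - 256 * (kS y : ℝ) := by
    intro y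
    show ∑ a, (((e a - S a : ℤ)) : ℝ) * twist a y = _
    have h1 : ∑ a, (((e a - S a : ℤ)) : ℝ) * twist a y = ∑ a, ((e a : ℤ) : ℝ) * twist a y - ∑ a, ((S a : ℤ) : ℝ) * twist a y := by
      rw [← sum_sub_distrib]; exact sum_congr rfl fun x _ => by push_cast; ring
    rw [h1, hkS y, tzl5_ehat f g u' hu' y]
  have hbridge : ∑ y, (128 * signOf (g y) - 2 * W (fun x => signOf (f x)) y - 256 * (kS y : ℝ)) ^ 2 ≤ 4096 * 1022 := by
    have hP2 := sum_W_sq (fun a => (((e a - S a : ℤ)) : ℝ))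
    simp_rw [hW] at hP2
    rw [hP2]
    have h1 : ∑ x, ((((e x - S x : ℤ)) : ℝ)) ^ 2 = ((∑ x, (e x - S x) ^ 2 : ℤ) : ℝ) := by push_cast; rfl
    have h2 : ((∑ x, (e x - S x) ^ 2 : ℤ) : ℝ) ≤ 1022 := by exact_mod_cast hpi
    rw [h1, show ((2 : ℝ) ^ (6 + 6)) = 4096 by norm_num]
    linarith
  -- the partner
  obtain ⟨u₄, hu₄⟩ := tw_base (n := 6 + 6) f hf 4 (by norm_num)
  have hcase5 : (∀ y, ¬ Odd (u₄ y)) → ∀ y, W (fun x => signOf (f x)) y = (2 : ℝ) ^ 5 * (((u₄ y / 2 : ℤ)) : ℝ) :=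
    fun hevf y => (tw_level_up (j := 4) f u₄ hu₄ hevf y).trans (by norm_num)
  have hcase6 : (∀ y, ¬ Odd (u₄ y)) → (∀ y, ¬ Odd (u₄ y / 2)) → ∀ y, W (fun x => signOf (f x)) y = (2 : ℝ) ^ 6 * (((u₄ y / 2 / 2 : ℤ)) : ℝ) :=
    fun hevf hevf' y => (tw_level_up (j := 5) f (fun y => u₄ y / 2) (hcase5 hevf) hevf' y).trans (by norm_num)
  have huniv : ∑ _y : Fin (6 + 6) → Bool, (1024 : ℝ) = 4096 * 1024 := by
    rw [sum_const, card_univ, Fintype.card_fun, Fintype.card_bool, Fintype.card_fin, nsmul_eq_mul]; norm_num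
  by_cases hO : ∃ y, Odd (u₄ y)
  · -- type-O partner: every term is `≥ 1024`
    obtain ⟨hall, -⟩ := tzp_typeO_struct f hf u₄ hu₄ hO
    have hpt : ∀ y, (1024 : ℝ) ≤ (128 * signOf (g y) - 2 * W (fun x => signOf (f x)) y - 256 * (kS y : ℝ)) ^ 2 := by
      intro y
      rw [hu₄ y, ← tp_sZ_cast (g y)]
      have e1 : (128 * ((sZ (g y) : ℤ) : ℝ) - 2 * ((2 : ℝ) ^ 4 * (u₄ y : ℝ)) - 256 * (kS y : ℝ)) ^ 2 =
          4 * (((64 * sZ (g y) - 16 * u₄ y - 128 * kS y) ^ 2 : ℤ) : ℝ) := by push_cast; ring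
      rw [e1]
      have h1 := (tzp_typeO_pt (u₄ y) (sZ (g y)) (kS y) (hall y) (tp_sZ_cases (g y))).1
      have : ((256 : ℤ) : ℝ) ≤ (((64 * sZ (g y) - 16 * u₄ y - 128 * kS y) ^ 2 : ℤ) : ℝ) := by exact_mod_cast h1
      norm_num at this ⊢; linarith
    have hsum := sum_le_sum fun y (_ : y ∈ (univ : Finset (Fin (6 + 6) → Bool))) => hpt y
    rw [huniv] at hsum
    linarith
  · push Not at hO
    have hu₅ := hcase5 hO
    by_cases h5 : ∃ y, Odd (u₄ y / 2)
    · -- level-5 partner: `≥ 4096` on the `≥ 2048` frequencies of its odd set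
      have hP'card := tzp_levelFive_card f hf (fun y => u₄ y / 2) hu₅ h5
      set P' := univ.filter (fun y : Fin (6 + 6) → Bool => Odd (u₄ y / 2)) with hP'def
      have hpt : ∀ y, (4096 : ℝ) * (if y ∈ P' then (1 : ℝ) else 0) ≤
          (128 * signOf (g y) - 2 * W (fun x => signOf (f x)) y - 256 * (kS y : ℝ)) ^ 2 := by
        intro y
        rw [hu₅ y, ← tp_sZ_cast (g y)]
        have e1 : (128 * ((sZ (g y) : ℤ) : ℝ) - 2 * ((2 : ℝ) ^ 5 * (((u₄ y / 2 : ℤ)) : ℝ)) - 256 * (kS y : ℝ)) ^ 2 =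
            4 * (((64 * sZ (g y) - 32 * (u₄ y / 2) - 128 * kS y) ^ 2 : ℤ) : ℝ) := by push_cast; ring
        rw [e1]
        by_cases hyP : y ∈ P'
        · rw [if_pos hyP]
          have h1 := tzp_levelFive_pt (u₄ y / 2) (sZ (g y)) (kS y) (mem_filter.1 hyP).2 (tp_sZ_cases (g y))
          have : ((1024 : ℤ) : ℝ) ≤ (((64 * sZ (g y) - 32 * (u₄ y / 2) - 128 * kS y) ^ 2 : ℤ) : ℝ) := by exact_mod_cast h1
          norm_num at this ⊢; linarith
        · rw [if_neg hyP]
          have : (0 : ℝ) ≤ (((64 * sZ (g y) - 32 * (u₄ y / 2) - 128 * kS y) ^ 2 : ℤ) : ℝ) := by positivity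
          norm_num at this ⊢; linarith
      have hsum := sum_le_sum fun y (_ : y ∈ (univ : Finset (Fin (6 + 6) → Bool))) => hpt y
      have hindP : ∑ y, (if y ∈ P' then (1 : ℝ) else 0) = #P' := by
        rw [sum_boole]
        have : (univ.filter fun y => y ∈ P') = P' := by ext y; simp
        rw [this]
      rw [← mul_sum, hindP] at hsum
      have hP'' : (2048 : ℝ) ≤ #P' := by exact_mod_cast hP'card
      nlinarith
    · -- level-`≥ 6` partner: excluded by `tz_levelSix_window_false` (roles swapped)
      push Not at h5
      have hΦ' : forrelation g f = forrelation f g := by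
        rw [Summit.QuantumAdvantage.QuantumAdvantage.Theorems.SignedCubicForrelationNotPrBPP.Negative.HalfQuad.forrelation_comm]
      exact tz_levelSix_window_false g f hg hf (fun y => u₄ y / 2 / 2) (hcase6 hO h5) (by rw [hΦ']; exact hlo) (by rw [hΦ']; exact hhi)

/-- **Every side of a window pair is TYPE O** (n = 12): cubic `f, g` with `57/64 < Φ(f,g) < 1` ⇒ `W_g = 16u` with every `u(x)` odd.
(`tz29_window_side_shape`: the only alternative was a level-5 side in case α, excluded by `tzk_alpha_window_false`.)  NO new value of
`θ₁₂`; finite-slice statement, NOT summit progress. [this work] -/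
theorem tz30_window_side_typeO (f g : (Fin (6 + 6) → Bool) → Bool) (hf : IsDegLeFun 3 f) (hg : IsDegLeFun 3 g)
    (hlo : (57 / 64 : ℝ) < forrelation f g) (hhi : forrelation f g < 1) :
    ∃ u : (Fin (6 + 6) → Bool) → ℤ, (∀ x, W (fun y => signOf (g y)) x = (2 : ℝ) ^ 4 * (u x : ℝ)) ∧ ∀ x, Odd (u x) := by
  obtain ⟨u, hu, hcases⟩ := tz29_window_side_shape f g hf hg hlo hhi
  rcases hcases with hO | ⟨hu5, h5, hα⟩
  · exact ⟨u, hu, hO⟩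
  · exact (tzk_alpha_window_false f g hf hg (fun x => u x / 2) hu5 h5 hlo hhi hα).elim

/-- **Both sides of a window pair are TYPE O** (n = 12): cubic `f, g` with `57/64 < Φ(f,g) < 1` ⇒ `W_f = 16u_f` and `W_g = 16u_g` with
all `u_f(y)`, `u_g(x)` odd.  What remains of the open window `(57/64, 29/32)` is the `(O,O)` pairing.  NO new value of `θ₁₂`; finite-slice
statement, NOT summit progress. [this work] -/
theorem tz30_window_pair_typeO (f g : (Fin (6 + 6) → Bool) → Bool) (hf : IsDegLeFun 3 f) (hg : IsDegLeFun 3 g)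
    (hlo : (57 / 64 : ℝ) < forrelation f g) (hhi : forrelation f g < 1) :
    (∃ u : (Fin (6 + 6) → Bool) → ℤ, (∀ y, W (fun x => signOf (f x)) y = (2 : ℝ) ^ 4 * (u y : ℝ)) ∧ ∀ y, Odd (u y)) ∧
    (∃ u : (Fin (6 + 6) → Bool) → ℤ, (∀ x, W (fun y => signOf (g y)) x = (2 : ℝ) ^ 4 * (u x : ℝ)) ∧ ∀ x, Odd (u x)) := by
  have hΦ' : forrelation g f = forrelation f g := by
    rw [Summit.QuantumAdvantage.QuantumAdvantage.Theorems.SignedCubicForrelationNotPrBPP.Negative.HalfQuad.forrelation_comm]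
  exact ⟨tz30_window_side_typeO g f hg hf (by rw [hΦ']; exact hlo) (by rw [hΦ']; exact hhi),
    tz30_window_side_typeO f g hf hg hlo hhi⟩

end Summit.QuantumAdvantage.QuantumAdvantage.Theorems.CubicForrelation.NearExactIsExact

end
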